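import Literature.Computability.AlgebraicComplexity.KV20KernelCircuitOutputs
import Literature.Computability.Complexity.SuccinctCircuitBitsSplitExt
import Literature.Computability.Complexity.SuccinctCircuitBitsReadout
import HarnessLib

/-!
# The succinct kernel-vector circuit, IV: a `PSPACE` sign/magnitude oracle for the kernel vector
# (uniform small-space linear algebra, packaged for any `FP` integer matrix family)

For an `FP` integer matrix family `Φ : SuccIntMatrixFamily` (`SuccinctKernelVectorGates.lean`) let
`v^{(n)} := charpolyKernelVector (A_nᵀ A_n)` (`Literature/LinearAlgebra/KernelVectorViaCharpoly.lean`: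
a canonical nonzero kernel vector of the Gram matrix whenever it is singular). This file proves,
for ANY polynomial-time query decoders `nq` (unary), `cq, jq, kq` (binary), that the language
"`kq = 1` and `v^{(nq)}_{cq} < 0`, or `kq = 0` and bit `jq` of `|v^{(nq)}_{cq}|` is set" is in
`PSPACE` (`KVC.kernelVector_signMag_mem_PSPACE`). It is the composition of
* the circuit's correctness `KVC.outName_val_sub` (`SuccinctKernelVectorValues.lean`) and height
  bound `KVC.outName_val_lt` (`KV20KernelCircuitOutputs.lean`),
* p1 g9's split-gate extension `SuccCircuit.splitExt` with its two's-complement representatives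
  `xpos_rep` / `xneg_rep` (`SuccinctCircuitBitsSplitExt.lean`), and
* p1 g9's read-out `SuccCircuit.signMag_mem_PSPACE_of_rep` over the certified polynomial-space
  evaluator (`SuccinctCircuitBitsReadout.lean`, `SuccinctCircuitBitsEvaluator.lean`).
This is the machine content of "the kernel of an exponentially large, succinctly given integer
matrix is computable in polynomial space" [BvzGH82, Thm. 2 and §5; KP09, §3.2 Prop. 1], of which
Kumar–Volk's Cor. 1.3 (`AC/KV20Cor13Holds.lean`) is the instance `Φ := kvMatrixFamily`.

Theorems and four plumbing definitions with bodies; no facts (D-0026); census +0.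

## References
* [BvzGH82] A. Borodin, J. von zur Gathen, J. Hopcroft, *Fast parallel matrix and GCD
  computations*, Inform. and Control 52 (1982), Thm. 2, §4–§5. [cite: BorodinVonzurgathenHopcroft1982, §5]
* [KP09] P. Koiran, S. Perifel, *VPSPACE and a transfer theorem over the reals*, Comput.
  Complexity 18 (2009), §3.2 Prop. 1. [cite: KoiranPerifel2009VPSPACE, §3.2]
* [AB09] S. Arora, B. Barak, *Computational Complexity* (2009), §4.2, §6.8. [cite: AroraBarak2009, §6.8]
-/

noncomputable section

namespace Literature.Computability.Complexity

namespace KVC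

open _root_.Computability CodeFP Brick SuccCircuit Literature.LinearAlgebra

variable (Φ : SuccIntMatrixFamily)

/-- **The kernel-vector entry** `v^{(n)}_c` of `A_nᵀ A_n` (on range `N n ≥ 2`, `c < N n`; `0`
otherwise). [cite: BorodinVonzurgathenHopcroft1982, §5 (NULLSPACE)] -/
def kvEntry (n c : ℕ) : ℤ :=
  if h : 2 ≤ Φ.N n ∧ c < Φ.N n then charpolyKernelVector ((Amat Φ n).transpose * Amat Φ n) ⟨c, h.2⟩ else 0

/-- The range test `N n ≥ 2 ∧ c < N n` (plumbing). [cite: AroraBarak2009, §1.3] -/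
def inR (n c : ℕ) : Bool := decide (2 ≤ Φ.N n) && decide (c < Φ.N n)

/-- The range test is polynomial-time. [cite: AroraBarak2009, §1.3] -/
theorem inR_fp : CodeFP (pairE unE natE) bitE (fun p => inR Φ p.1 p.2) :=
  ((natLe.comp ((const _ 2).pair (Φ.N_fp.comp (fst _ _)))).and
    (natLt.comp ((snd _ _).pair (Φ.N_fp.comp (fst _ _))))).congr fun _ => rfl

/-- The range test, read back. [cite: AroraBarak2009, §1.3] -/
theorem inR_eq_true_iff (n c : ℕ) : inR Φ n c = true ↔ 2 ≤ Φ.N n ∧ c < Φ.N n := by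
  simp [inR]

/-- **The positive representative gate**: `X⁺` of the split extension over the two output gates
(the zero gate off range). [cite: KnuthTAOCP2, §4.1] [cite: KoiranPerifel2009VPSPACE, §3.2] -/
def posName (n c : ℕ) : List Bool :=
  if inR Φ n c then xposName (splitPayload (Φ.Wmux n) (outName Φ n 0 c) (outName Φ n 1 c)) else zeroName

/-- **The negative representative gate** `X⁻`. [cite: KnuthTAOCP2, §4.1] [cite: KoiranPerifel2009VPSPACE, §3.2] -/
def negName (n c : ℕ) : List Bool :=
  if inR Φ n c then xnegName (splitPayload (Φ.Wmux n) (outName Φ n 0 c) (outName Φ n 1 c)) else zeroName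

/-- The payload `⟨Wmux n, V(0,c), V(1,c)⟩` is polynomial-time. [cite: AroraBarak2009, §1.3] -/
theorem payload_fp : CodeFP (pairE unE natE) strE
    (fun p => splitPayload (Φ.Wmux p.1) (outName Φ p.1 0 p.2) (outName Φ p.1 1 p.2)) :=
  (splitPayload_fp.comp (((Wmux_fp Φ).comp (fst _ _)).pair ((codeFP_outName₀ Φ).pair (codeFP_outName₁ Φ)))).congr
    fun _ => rfl

/-- `posName` is polynomial-time. [cite: AroraBarak2009, §1.3] -/
theorem posName_fp : CodeFP (pairE unE natE) strE (fun p => posName Φ p.1 p.2) :=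
  ((inR_fp Φ).ite (xposName_fp.comp (payload_fp Φ)) (const _ zeroName)).congr fun _ => rfl

/-- `negName` is polynomial-time. [cite: AroraBarak2009, §1.3] -/
theorem negName_fp : CodeFP (pairE unE natE) strE (fun p => negName Φ p.1 p.2) :=
  ((inR_fp Φ).ite (xnegName_fp.comp (payload_fp Φ)) (const _ zeroName)).congr fun _ => rfl

/-- **Height bound**: `|v^{(n)}_c| < 2^{Wmux n}`. [cite: KoiranPerifel2009VPSPACE, §3.2, Prop. 1] -/
theorem natAbs_kvEntry_lt (n c : ℕ) : (kvEntry Φ n c).natAbs < 2 ^ Φ.Wmux n := by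
  unfold kvEntry
  split_ifs with h
  · rw [← outName_val_sub Φ h.1 ⟨c, h.2⟩]
    have h0 := outName_val_lt Φ (n := n) (s := 0) (by norm_num) h.2
    have h1 := outName_val_lt Φ (n := n) (s := 1) (by norm_num) h.2
    simp only at h0 h1 ⊢
    omega
  · simp

/-- **`X⁺` represents `v^{(n)}_c`** modulo `2^{Wmux n + 1}`. [cite: KnuthTAOCP2, §4.1] -/
theorem posName_rep (n c : ℕ) :
    (((kvc Φ).splitExt.val (posName Φ n c) : ℕ) : ℤ) ≡ kvEntry Φ n c [ZMOD 2 ^ (Φ.Wmux n + 1)] := by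
  unfold posName kvEntry
  by_cases h : 2 ≤ Φ.N n ∧ c < Φ.N n
  · rw [if_pos ((inR_eq_true_iff Φ n c).2 h), dif_pos h, ← outName_val_sub Φ h.1 ⟨c, h.2⟩]
    exact xpos_rep _ _ _ _
  · rw [if_neg (mt (inR_eq_true_iff Φ n c).1 h), dif_neg h, val_splitExt_zero, Nat.cast_zero]

/-- **`X⁻` represents `−v^{(n)}_c`** modulo `2^{Wmux n + 1}`. [cite: KnuthTAOCP2, §4.1] -/
theorem negName_rep (n c : ℕ) :
    (((kvc Φ).splitExt.val (negName Φ n c) : ℕ) : ℤ) ≡ -kvEntry Φ n c [ZMOD 2 ^ (Φ.Wmux n + 1)] := by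
  unfold negName kvEntry
  by_cases h : 2 ≤ Φ.N n ∧ c < Φ.N n
  · rw [if_pos ((inR_eq_true_iff Φ n c).2 h), dif_pos h, ← outName_val_sub Φ h.1 ⟨c, h.2⟩]
    exact xneg_rep _ _ _ _
  · rw [if_neg (mt (inR_eq_true_iff Φ n c).1 h), dif_neg h, val_splitExt_zero, Nat.cast_zero, neg_zero]

/-- **What the oracle answers is a kernel vector**: on range, `kvEntry Φ n ·` is the canonical kernel
vector `v := charpolyKernelVector (A_nᵀ A_n)`; it is `≠ 0` and satisfies `A_n v = 0` as soon as `A_n`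
has some nonzero (integer) kernel vector (x5 g6's `charpolyKernelVector_gram_spec`).
[cite: BorodinVonzurgathenHopcroft1982, Thm. 2 and §5 (NULLSPACE)] -/
theorem kvEntry_spec {n : ℕ} (hN : 2 ≤ Φ.N n) {u : Fin (Φ.N n) → ℤ} (hu : u ≠ 0)
    (hAu : (Amat Φ n).mulVec u = 0) :
    (fun c : Fin (Φ.N n) => kvEntry Φ n c) ≠ 0 ∧ (Amat Φ n).mulVec (fun c : Fin (Φ.N n) => kvEntry Φ n c) = 0 := by
  haveI : Nonempty (Fin (Φ.N n)) := ⟨⟨0, by omega⟩⟩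
  have hv : (fun c : Fin (Φ.N n) => kvEntry Φ n c) = charpolyKernelVector ((Amat Φ n).transpose * Amat Φ n) := by
    funext c; unfold kvEntry; rw [dif_pos ⟨hN, c.isLt⟩]
  rw [hv]
  exact charpolyKernelVector_gram_spec (Amat Φ n) hu hAu

/-- ★★ **Theorem (a `PSPACE` sign/magnitude oracle for the kernel vector of a succinct Gram matrix).**
For every `FP` integer matrix family `Φ` and all polynomial-time query decoders `nq` (unary index),
`cq`, `jq`, `kq` (binary), the language of strings `w` with "`kq w = 1` and `v_{cq w} < 0`" or
"`kq w = 0` and bit `jq w` of `|v_{cq w}|` is `1`", where `v = charpolyKernelVector (A_nᵀ A_n)`,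
`n = nq w`, is in `PSPACE`. [cite: BorodinVonzurgathenHopcroft1982, Thm. 2 and §5 (NULLSPACE)] [cite: KoiranPerifel2009VPSPACE, §3.2, Prop. 1] [cite: AroraBarak2009, §4.2] -/
theorem kernelVector_signMag_mem_PSPACE {nq cq jq kq : List Bool → ℕ} (hn : CodeFP strE unE nq)
    (hc : CodeFP strE natE cq) (hj : CodeFP strE natE jq) (hk : CodeFP strE natE kq) :
    ({w | (kq w = 1 ∧ kvEntry Φ (nq w) (cq w) < 0) ∨
        (kq w = 0 ∧ (kvEntry Φ (nq w) (cq w)).natAbs.testBit (jq w) = true)} : Language Bool) ∈ PSPACE :=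
  signMag_mem_PSPACE_of_rep (kvc Φ).splitExt (pos := fun w => posName Φ (nq w) (cq w))
    (neg := fun w => negName Φ (nq w) (cq w)) (idx := jq) (knd := kq) (v := fun w => Φ.Wmux (nq w))
    (x := fun w => kvEntry Φ (nq w) (cq w))
    (((posName_fp Φ).comp (hn.pair hc)).congr fun _ => rfl) (((negName_fp Φ).comp (hn.pair hc)).congr fun _ => rfl)
    hj hk (((Wmux_fp Φ).comp hn).congr fun _ => rfl)
    (fun _ => natAbs_kvEntry_lt Φ _ _) (fun _ => posName_rep Φ _ _) (fun _ => negName_rep Φ _ _)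

end KVC

end Literature.Computability.Complexity

end
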